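import Summits.CriticalPhenomena.PercolationContinuityZ3.Theorems.PercNearOneGluingNoHeavyPcintChainMemZ4C10Check1
import Summits.CriticalPhenomena.PercolationContinuityZ3.Theorems.PercNearOneGluingNoHeavyPcintChainMemZ4C10Check2
import Summits.CriticalPhenomena.PercolationContinuityZ3.Theorems.PercNearOneGluingNoHeavyPcintChainMemZ4C10Check3
import Summits.CriticalPhenomena.PercolationContinuityZ3.Theorems.PercNearOneGluingNoHeavyPcintChainMemZ4C10Check4
import Summits.CriticalPhenomena.PercolationContinuityZ3.Theorems.PercNearOneGluingNoHeavyPcintChainMemZ4C10Check5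
import Summits.CriticalPhenomena.PercolationContinuityZ3.Theorems.PercNearOneGluingNoHeavyPcintChainMemZ4C10Check6
import HarnessLib

/-!
# PCINT lane, kernel reduced-state B3c certificate `Z4C10` (bond, d = 4, memory τ = 10, kc = 4, 5727 state classes): the theorem `p_c^bond(ℤ^4) ≥ 0.1513`

Cell `prim-pcint`, seat `prim-pcint-2` (gen 4); memo `run/shared/lean/prim/pcint/REDUCTIONS.md` §B3c and HANDOFF ("B3c on reduced states").
Does NOT build on p205010.  Data for `BondK.le_criticalProb_of_checkRowsC` (`…PcintChainMemKernelCert`): `p = 15130/100000`, chain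
parameter `kc = 4`, `s̄ = 98849/100000` (`s̄²+p² ≥ 1`), refund `r = 101165/100000` (`s̄·r ≥ 1`, `(1-p)·r² ≤ 1`), `κ̄ = (100000²+98849²)/(2·100000²)`,
`λ = 99999/100000`; Collatz–Wielandt weights (scale 10⁹) from a power iteration (ρ ≈ 0.9995276), exact off-line max row ratio
0.9995275580 < λ.  Generated by work/gen/gen_b3c_kernel.py (prim-pcint-2 gen 4 folder; copy in
run/shared/lean/prim/pcint/prim-pcint-2/kernel/); the kernel re-checks every row.
-/

namespace Summit.CriticalPhenomena.PercolationContinuityZ3.Theorems.Pcint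

open Literature.Probability.Percolation Literature.Probability.LatticeModels

/-- Every row of the certificate passes. [folklore] -/
theorem ChainMemZ4C10.all_rows : WinK.allRange (BondK.checkRowC 10 4 4 5727 15130 101165 98849 100000 99999 100000 ChainMemZ4C10.syms ChainMemZ4C10.tree) 0 5727 = true := (WinK.allRange_split (WinK.allRange_split (WinK.allRange_split (WinK.allRange_split (WinK.allRange_split ChainMemZ4C10.file_1 ChainMemZ4C10.file_2) ChainMemZ4C10.file_3) ChainMemZ4C10.file_4) ChainMemZ4C10.file_5) ChainMemZ4C10.file_6)

/-- **`p_c^bond(ℤ^4) ≥ 0.1513`** (kernel-checked reduced-state B3c certificate: `chordrand` + chain-bonus weights on the memory-`10`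
dangerous-set automaton, chain parameter `kc = 4`, 5727 state classes, `decide +kernel` only). [folklore] -/
theorem criticalProb_Z4_ge_01513 : (0.1513 : ℝ) ≤ criticalProb (zdGraph 4) 0 := by
  have h := BondK.le_criticalProb_of_checkRowsC (d := 4) (τ := 10) (kc := 4) (N := 5727) (pn := 15130) (R := 101165) (S := 98849)
    (D := 100000) (lamN := 99999) (lamD := 100000) (syms := ChainMemZ4C10.syms) (t := ChainMemZ4C10.tree) (by norm_num) (by norm_num)
    (fun c => NawK.symOfTab 4 (ChainMemZ4C10.syms.getD c [])) (NawK.syms_spec_of_valid ChainMemZ4C10.syms_valid)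
    (fun i hi => WinK.of_allRange ChainMemZ4C10.all_rows (Nat.zero_le i) hi)
    (by norm_num) (by decide +kernel) (by norm_num) (by norm_num) (by norm_num) (by norm_num) (by norm_num) (by norm_num)
    (by norm_num) (by norm_num)
  have e : ((15130 : ℕ) : ℝ) / ((100000 : ℕ) : ℝ) = (0.1513 : ℝ) := by norm_num
  rw [e] at h
  exact h

end Summit.CriticalPhenomena.PercolationContinuityZ3.Theorems.Pcint
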